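import Summits.HodgeConjecture.CorCM.IrreducibleOddWeightsIsotypicFrobenius
import HarnessLib

/-!
# Isotypic cells, Frobenius II: `dim Hom_G(ℚ^{Y₀}, A_c) = m_c·δ_c` — the Hom-space of a slot into a reference
# irreducible is `∏_{j ∈ J_c} 𝒟_c·a₀` through the isotypic decomposition

COR-CM (cell `pub-hodgecm2`, binder seat `b16` gen 77, count-neutral claim FROBENIUS RECIPROCITY IN THE REFERENCE
CURRENCY — MULTIPLICITIES FROM FIXED POINTS, file R2 — abstract `G`-set level, sequel of R1
`CorCM/IrreducibleOddWeightsIsotypicFrobenius`; theorems only, no definition, no named fact, no `sorry`).  NEW as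
stated, hence under `Summits/`.  HONEST FRAMING: finite-dimensional linear algebra (the rational form of Frobenius
reciprocity for permutation modules, Lange–Rodríguez Lemma 2.8.1 «`ρ_H = ⊕_j (dim V_j^H / s_j)·W_j`», in the
unbundled reference currency of gen 72–76: no characters, no finiteness of `G`, the Schur index absorbed in
`δ_c = dim_ℚ End_G(A_c)`); it makes the multiplicities `m_{i,c}` of gen 76 E3/E5 COMPUTABLE from the reference
`A_c` and the stabiliser alone — closing HONEST OPEN (iii) of the gen 76 card; nothing about Hodge classes is
asserted, `HC_CM` is neither used nor asserted.

SETTING (gen 75 M-series / gen 76 E-series hypotheses, ONE slot).  `Y₀` a finite `G`-set with a point `x₀`,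
transitive (`∀ x ∃ g, g·x₀ = x`); references `A_c ≤ ℚ^{Y_c}` (`c ∈ C`) stable irreducible pairwise
non-embeddable (`hRst`, `hRirr`, `hsep`); linear `ι_{c,j} : ℚ^{Y_c} → ℚ^{Y₀}` (`j ∈ J_c`) equivariant on `A_c`
(`hιeq`) and injective on `A_c` (`hinj`), with images `ι_{c,j}(A_c)` INDEPENDENT (`hindep`, over `Σ c, J_c`) and
spanning `ℚ^{Y₀}` (`htop`) — so `|J_c| = m_c` is the multiplicity of `A_c` in `ℚ^{Y₀}`; a class `c₀` with
commutant `𝒟` of `A = A_{c₀}` (`h𝒟`, translate form), `0 ≠ a₀ ∈ A`, `δ = dim 𝒟·a₀`; the Hom-space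
`𝓗 = Hom_G(ℚ^{Y₀}, A)` (`h𝓗`, file R1) and the fixed subspace `F` of `Stab(x₀)` in `ℚ^{Y_{c₀}}` (`hF`).

* §1 `exists_equivariant_proj_summand` (the projection of `ℚ^{Y₀} = ⊕_{c,j} ι_{c,j}(A_c)` onto one summand
  along the others is an EQUIVARIANT linear map), `exists_equivariant_inverse` (an equivariant inverse
  `ℚ^{Y₀} → ℚ^{Y_c}` of `ι_{c,j}` on its image).
* §2 `Ψ(L) = (L(ι_{c₀,j} a₀))_j`: `apply_ι_mem_map_applyₗ_of_mem_homSpace` (`Ψ(𝓗) ⊆ ∏_j 𝒟·a₀`, as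
  `L ∘ ι_{c₀,j} ∈ 𝒟`), **`eq_zero_of_mem_homSpace_of_forall_apply_ι_eq_zero`** (`Ψ` is INJECTIVE on `𝓗`: Schur on
  `L ∘ ι_{c₀,j} ∈ 𝒟`, the non-embeddable classes are killed (R1), the images span),
  **`exists_mem_homSpace_forall_apply_ι_eq`** (`Ψ` maps `𝓗` ONTO `∏_j 𝒟·a₀`: `L = Σ_j d_j ∘ θ_j ∘ π_j`),
  `map_homSpace_pi_applyₗ_eq`, **`finrank_homSpace_eq_card_mul`: `dim Hom_G(ℚ^{Y₀}, A_{c₀}) = |J_{c₀}|·δ`**.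
Sequel R3 `CorCM/IrreducibleOddWeightsIsotypicFrobeniusCount`: with R1 (`dim Hom_G(ℚ^{Y₀}, A) = dim A^{Stab(x₀)}`)
THE COUNT `|J_{c₀}|·δ_{c₀} = dim A_{c₀}^{Stab(x₀)}` and its corollaries.

## References

* [LangeRodriguez2022] H. Lange, R. E. Rodríguez, *Decomposition of Jacobians by Prym Varieties*, LNM 2310 (2022),
  §2.8 eq. (2.18) and Lemma 2.8.1.
* [Serre1977] J.-P. Serre, *Linear Representations of Finite Groups*, GTM 42, §2.6 (canonical decomposition),
  §3.3 Lemma 1, §7.2 Thm. 13 (Frobenius reciprocity), §12.1–12.2 (representations over `ℚ`, Schur index).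
* [CurtisReiner1962] C. W. Curtis, I. Reiner, *Representation Theory of Finite Groups and Associative Algebras*,
  §27 (27.3).
* [Lang2002] S. Lang, *Algebra*, 3rd ed., XVII §1–§3.
-/

set_option autoImplicit false

noncomputable section

open scoped BigOperators Classical

universe v vA vC uC uJ w

namespace Summit.HodgeConjecture.CorCM.IrrOdd

variable {G : Type w} [Group G] {Y₀ : Type v} [MulAction G Y₀]

/-! ### §1 Equivariant projections onto the summands; equivariant inverses of the embeddings -/

section Tools

variable {C : Type uC} [Fintype C] {Yc : C → Type vC} [∀ c, MulAction G (Yc c)]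
  {Ar : ∀ c, Submodule ℚ (Yc c → ℚ)} {JJ : C → Type uJ} [∀ c, Fintype (JJ c)]

/-- **THE PROJECTION ONTO ONE SUMMAND OF `ℚ^{Y₀} = ⊕_{c,j} ι_{c,j}(A_c)` ALONG THE OTHERS IS EQUIVARIANT**: for
`A_c` stable, `ι_{c,j}` equivariant on `A_c`, images independent and spanning, and a summand `q₀ = (c, j)`, there
is a linear `π : ℚ^{Y₀} → ℚ^{Y₀}` with values in `ι_{q₀}(A)`, the identity there, zero on every other summand,
commuting with all translates. [cite: Serre1977, §2.6] [cite: Lang2002, XVII §2] -/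
theorem exists_equivariant_proj_summand
    (hRst : ∀ c (k : G) (a : Yc c → ℚ), a ∈ Ar c → (fun y => a (k • y)) ∈ Ar c)
    (ι : ∀ c, JJ c → ((Yc c → ℚ) →ₗ[ℚ] (Y₀ → ℚ)))
    (hιeq : ∀ c (j : JJ c) (k : G) (a : Yc c → ℚ), a ∈ Ar c →
      ι c j (fun y => a (k • y)) = fun y => ι c j a (k • y))
    (hindep : iSupIndep fun q : (Σ c, JJ c) => (Ar q.1).map (ι q.1 q.2))
    (htop : (⨆ c, ⨆ j, (Ar c).map (ι c j)) = ⊤) (q₀ : Σ c, JJ c) :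
    ∃ π : (Y₀ → ℚ) →ₗ[ℚ] (Y₀ → ℚ), (∀ v, π v ∈ (Ar q₀.1).map (ι q₀.1 q₀.2)) ∧
      (∀ v ∈ (Ar q₀.1).map (ι q₀.1 q₀.2), π v = v) ∧
      (∀ q : (Σ c, JJ c), q ≠ q₀ → ∀ v ∈ (Ar q.1).map (ι q.1 q.2), π v = 0) ∧
      ∀ (k : G) (v : Y₀ → ℚ), π (fun y => v (k • y)) = fun y => π v (k • y) := by
  let T : G → (Y₀ → ℚ) →ₗ[ℚ] (Y₀ → ℚ) := fun k => LinearMap.funLeft ℚ ℚ fun y : Y₀ => k • y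
  have hNst : ∀ (q : Σ c, JJ c) (k : G) (v : Y₀ → ℚ), v ∈ (Ar q.1).map (ι q.1 q.2) →
      T k v ∈ (Ar q.1).map (ι q.1 q.2) := by
    rintro q k _ ⟨a, ha, rfl⟩
    exact ⟨fun y => a (k • y), hRst q.1 k a ha, hιeq q.1 q.2 k a ha⟩
  set P : Submodule ℚ (Y₀ → ℚ) := (Ar q₀.1).map (ι q₀.1 q₀.2) with hP
  set Q : Submodule ℚ (Y₀ → ℚ) :=
    ⨆ q : {q : Σ c, JJ c // q ≠ q₀}, (Ar q.1.1).map (ι q.1.1 q.1.2) with hQ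
  have hPst : ∀ (k : G) (v : Y₀ → ℚ), v ∈ P → T k v ∈ P := hNst q₀
  have hQst : ∀ (k : G) (v : Y₀ → ℚ), v ∈ Q → T k v ∈ Q :=
    stable_iSup T _ fun q k v hv => hNst q.1 k v hv
  have hQeq : (⨆ (q : Σ c, JJ c) (_ : q ≠ q₀), (Ar q.1).map (ι q.1 q.2)) = Q := by
    refine le_antisymm (iSup₂_le fun q hq => ?_) (iSup_le fun q => ?_)
    · exact le_iSup (fun q : {q : Σ c, JJ c // q ≠ q₀} => (Ar q.1.1).map (ι q.1.1 q.1.2)) ⟨q, hq⟩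
    · exact le_iSup₂ (f := fun (q : Σ c, JJ c) (_ : q ≠ q₀) => (Ar q.1).map (ι q.1 q.2)) q.1 q.2
  have hPQ : P ⊓ Q = ⊥ := by
    have h := hindep q₀
    rw [hQeq] at h
    exact disjoint_iff.1 h
  have hPQtop : P ⊔ Q = ⊤ := by
    have hsig : (⨆ q : (Σ c, JJ c), (Ar q.1).map (ι q.1 q.2)) = ⊤ := by
      rw [iSup_sigma]
      exact htop
    rw [← hQeq, hP, ← iSup_split_single (fun q : (Σ c, JJ c) => (Ar q.1).map (ι q.1 q.2)) q₀, hsig]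
  obtain ⟨π, hπP, hπid, hπQ, -, hπeq⟩ := exists_proj_of_inf_eq_bot T hPst hQst hPQ
  have hmem : ∀ v : Y₀ → ℚ, v ∈ P ⊔ Q := fun v => by rw [hPQtop]; exact Submodule.mem_top
  refine ⟨π, hπP, hπid, fun q hq v hv => hπQ v ?_, fun k v => hπeq k v (hmem v)⟩
  rw [← hQeq]
  exact Submodule.mem_iSup_of_mem q (Submodule.mem_iSup_of_mem hq hv)

/-- **AN EMBEDDING HAS AN EQUIVARIANT INVERSE ON ITS IMAGE**: for `A ≤ ℚ^{Y_A}` stable and `θ′ : ℚ^{Y_A} → ℚ^{Y₀}`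
injective and equivariant on `A` there is a linear `θ : ℚ^{Y₀} → ℚ^{Y_A}` with `θ(θ′ a) = a` on `A`,
`θ(θ′(A)) ⊆ A`, commuting with the translates on `θ′(A)`. [cite: Serre1977, §2.2] [cite: Lang2002, XVII §1] -/
theorem exists_equivariant_inverse {YA : Type vA} [MulAction G YA] {A : Submodule ℚ (YA → ℚ)}
    (hAst : ∀ (k : G) (a : YA → ℚ), a ∈ A → (fun y => a (k • y)) ∈ A)
    (θ' : (YA → ℚ) →ₗ[ℚ] (Y₀ → ℚ)) (hinj : ∀ a ∈ A, θ' a = 0 → a = 0)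
    (hθ'eq : ∀ (k : G) (a : YA → ℚ), a ∈ A → θ' (fun y => a (k • y)) = fun x => θ' a (k • x)) :
    ∃ θ : (Y₀ → ℚ) →ₗ[ℚ] (YA → ℚ), (∀ a ∈ A, θ (θ' a) = a) ∧ (∀ v ∈ A.map θ', θ v ∈ A) ∧
      ∀ (k : G) (v : Y₀ → ℚ), v ∈ A.map θ' → θ (fun x => v (k • x)) = fun y => θ v (k • y) := by
  -- the restriction `f : A → θ′(A)` is a linear bijection
  let f : A →ₗ[ℚ] ↥(A.map θ') :=
    LinearMap.codRestrict (A.map θ') (θ'.domRestrict A) fun a => Submodule.mem_map_of_mem a.2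
  have hf : ∀ a : A, (f a : Y₀ → ℚ) = θ' a := fun a => rfl
  have hfinj : Function.Injective f := by
    intro a b hab
    apply Subtype.ext
    have h := congrArg (fun x : ↥(A.map θ') => (x : Y₀ → ℚ)) hab
    simp only [hf] at h
    have h0 : θ' ((a : YA → ℚ) - b) = 0 := by rw [map_sub, h, sub_self]
    exact sub_eq_zero.1 (hinj _ (A.sub_mem a.2 b.2) h0)
  have hfsurj : Function.Surjective f := by
    rintro ⟨v, hv⟩
    obtain ⟨a, ha, rfl⟩ := Submodule.mem_map.1 hv
    exact ⟨⟨a, ha⟩, Subtype.ext (hf ⟨a, ha⟩)⟩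
  let e : A ≃ₗ[ℚ] ↥(A.map θ') := LinearEquiv.ofBijective f ⟨hfinj, hfsurj⟩
  have he : ∀ a : A, (e a : Y₀ → ℚ) = θ' a := fun a => rfl
  obtain ⟨θ, hθ⟩ := LinearMap.exists_extend (A.subtype ∘ₗ (e.symm : ↥(A.map θ') →ₗ[ℚ] A))
  have hθapply : ∀ v : ↥(A.map θ'), θ v = (e.symm v : YA → ℚ) := fun v => by
    have h := LinearMap.congr_fun hθ v
    simpa using h
  have hleft : ∀ a ∈ A, θ (θ' a) = a := fun a ha => by
    rw [← he ⟨a, ha⟩, hθapply, LinearEquiv.symm_apply_apply]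
  have hmem : ∀ v ∈ A.map θ', θ v ∈ A := fun v hv => by
    rw [hθapply ⟨v, hv⟩]
    exact Submodule.coe_mem _
  refine ⟨θ, hleft, hmem, fun k v hv => ?_⟩
  obtain ⟨a, ha, rfl⟩ := Submodule.mem_map.1 hv
  rw [hleft a ha, ← hθ'eq k a ha, hleft _ (hAst k a ha)]

end Tools

/-! ### §2 `Ψ(L) = (L(ι_{c₀,j} a₀))_j` identifies `Hom_G(ℚ^{Y₀}, A_{c₀})` with `∏_{j ∈ J_{c₀}} 𝒟·a₀` -/

section Psi

variable {C : Type uC} [Fintype C] {Yc : C → Type vC} [∀ c, MulAction G (Yc c)]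
  {Ar : ∀ c, Submodule ℚ (Yc c → ℚ)} {JJ : C → Type uJ} [∀ c, Fintype (JJ c)] {c₀ : C}
  {𝒟 : Submodule ℚ ((Yc c₀ → ℚ) →ₗ[ℚ] (Yc c₀ → ℚ))}
  {𝓗 : Submodule ℚ ((Y₀ → ℚ) →ₗ[ℚ] (Yc c₀ → ℚ))}

omit [Fintype C] [∀ c, Fintype (JJ c)] in
/-- **`Ψ(𝓗) ⊆ ∏_j 𝒟·a₀`**: for `L ∈ Hom_G(ℚ^{Y₀}, A_{c₀})`, `L(ι_{c₀,j} a₀) = (L ∘ ι_{c₀,j})(a₀)` with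
`L ∘ ι_{c₀,j} ∈ 𝒟` (file R1). [cite: CurtisReiner1962, §27 (27.3)] -/
theorem apply_ι_mem_map_applyₗ_of_mem_homSpace
    (h𝓗 : ∀ L : (Y₀ → ℚ) →ₗ[ℚ] (Yc c₀ → ℚ), L ∈ 𝓗 ↔ (∀ f, L f ∈ Ar c₀) ∧
      ∀ (k : G) (f : Y₀ → ℚ), L (fun x => f (k • x)) = fun y => L f (k • y))
    (h𝒟 : ∀ L : (Yc c₀ → ℚ) →ₗ[ℚ] (Yc c₀ → ℚ), L ∈ 𝒟 ↔ (∀ a ∈ Ar c₀, L a ∈ Ar c₀) ∧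
      ∀ (k : G) (a : Yc c₀ → ℚ), a ∈ Ar c₀ → L (fun y => a (k • y)) = fun y => L a (k • y))
    (ι : ∀ c, JJ c → ((Yc c → ℚ) →ₗ[ℚ] (Y₀ → ℚ)))
    (hιeq : ∀ c (j : JJ c) (k : G) (a : Yc c → ℚ), a ∈ Ar c →
      ι c j (fun y => a (k • y)) = fun y => ι c j a (k • y))
    {L : (Y₀ → ℚ) →ₗ[ℚ] (Yc c₀ → ℚ)} (hL : L ∈ 𝓗) (a₀ : Yc c₀ → ℚ) (j : JJ c₀) :
    L (ι c₀ j a₀) ∈ 𝒟.map (LinearMap.applyₗ a₀) :=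
  ⟨L ∘ₗ ι c₀ j, comp_mem_commutant_of_mem_homSpace h𝓗 h𝒟 hL (ι c₀ j) (hιeq c₀ j), rfl⟩

omit [Fintype C] [∀ c, Fintype (JJ c)] in
/-- **`Ψ` IS INJECTIVE ON `Hom_G(ℚ^{Y₀}, A_{c₀})`**: if `L(ι_{c₀,j} a₀) = 0` for every `j` (`0 ≠ a₀ ∈ A_{c₀}`)
then `L = 0` — `L ∘ ι_{c₀,j} ∈ 𝒟` kills `a₀`, hence `A_{c₀}` (Schur); `L` kills every `ι_{c,j}(A_c)` with
`c ≠ c₀` (no embedding `A_c ↪ A_{c₀}`, file R1); and the images span `ℚ^{Y₀}`. [cite: Serre1977, §2.2 and §2.6]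
[cite: CurtisReiner1962, §27 (27.3)] -/
theorem eq_zero_of_mem_homSpace_of_forall_apply_ι_eq_zero
    (h𝓗 : ∀ L : (Y₀ → ℚ) →ₗ[ℚ] (Yc c₀ → ℚ), L ∈ 𝓗 ↔ (∀ f, L f ∈ Ar c₀) ∧
      ∀ (k : G) (f : Y₀ → ℚ), L (fun x => f (k • x)) = fun y => L f (k • y))
    (h𝒟 : ∀ L : (Yc c₀ → ℚ) →ₗ[ℚ] (Yc c₀ → ℚ), L ∈ 𝒟 ↔ (∀ a ∈ Ar c₀, L a ∈ Ar c₀) ∧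
      ∀ (k : G) (a : Yc c₀ → ℚ), a ∈ Ar c₀ → L (fun y => a (k • y)) = fun y => L a (k • y))
    (hRst : ∀ c (k : G) (a : Yc c → ℚ), a ∈ Ar c → (fun y => a (k • y)) ∈ Ar c)
    (hRirr : ∀ c (W : Submodule ℚ (Yc c → ℚ)), W ≤ Ar c → W ≠ ⊥ →
      (∀ (k : G) (f : Yc c → ℚ), f ∈ W → (fun y => f (k • y)) ∈ W) → W = Ar c)
    (hsep : ∀ c c' (L : (Yc c → ℚ) →ₗ[ℚ] (Yc c' → ℚ)), c ≠ c' → Ar c ≠ ⊥ → (∀ a ∈ Ar c, L a ∈ Ar c') →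
      (∀ a ∈ Ar c, L a = 0 → a = 0) →
      (∀ (k : G) (a : Yc c → ℚ), a ∈ Ar c → L (fun y => a (k • y)) = fun y => L a (k • y)) → False)
    (ι : ∀ c, JJ c → ((Yc c → ℚ) →ₗ[ℚ] (Y₀ → ℚ)))
    (hιeq : ∀ c (j : JJ c) (k : G) (a : Yc c → ℚ), a ∈ Ar c →
      ι c j (fun y => a (k • y)) = fun y => ι c j a (k • y))
    (htop : (⨆ c, ⨆ j, (Ar c).map (ι c j)) = ⊤)
    {a₀ : Yc c₀ → ℚ} (ha₀ : a₀ ∈ Ar c₀) (h0 : a₀ ≠ 0)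
    {L : (Y₀ → ℚ) →ₗ[ℚ] (Yc c₀ → ℚ)} (hL : L ∈ 𝓗) (hzero : ∀ j : JJ c₀, L (ι c₀ j a₀) = 0) : L = 0 := by
  let T : G → (Yc c₀ → ℚ) →ₗ[ℚ] (Yc c₀ → ℚ) := fun k => LinearMap.funLeft ℚ ℚ fun y : Yc c₀ => k • y
  -- `L` kills every summand
  have hkill : ∀ (c : C) (j : JJ c), ∀ a ∈ Ar c, L (ι c j a) = 0 := by
    intro c j
    by_cases hc : c = c₀
    · subst hc
      have hmem : L ∘ₗ ι c j ∈ 𝒟 := comp_mem_commutant_of_mem_homSpace h𝓗 h𝒟 hL (ι c j) (hιeq c j)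
      rcases commutant_zero_or_injOn T (𝒟 := 𝒟) (A := Ar c) (fun L' => h𝒟 L') (fun k a ha => hRst c k a ha)
          (fun W hW hW0 hWst => hRirr c W hW hW0 fun k f hf => hWst k f hf) hmem with hz | hi
      · exact fun a ha => hz a ha
      · exact absurd (hi a₀ ha₀ (hzero j)) h0
    · by_cases hbot : Ar c = ⊥
      · intro a ha
        rw [hbot, Submodule.mem_bot] at ha
        rw [ha, map_zero, map_zero]
      · exact apply_eq_zero_of_mem_homSpace_of_not_embed h𝓗 hL (hRst c) (hRirr c) (ι c j) (hιeq c j)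
          fun L' h1 h2 h3 => hsep c c₀ L' hc hbot h1 h2 h3
  have hker : (⨆ c, ⨆ j, (Ar c).map (ι c j)) ≤ LinearMap.ker L :=
    iSup_le fun c => iSup_le fun j => by
      rintro _ ⟨a, ha, rfl⟩
      exact LinearMap.mem_ker.2 (hkill c j a ha)
  rw [htop] at hker
  refine LinearMap.ext fun f => ?_
  rw [LinearMap.zero_apply]
  exact LinearMap.mem_ker.1 (hker Submodule.mem_top)

/-- **`Ψ` MAPS `Hom_G(ℚ^{Y₀}, A_{c₀})` ONTO `∏_j 𝒟·a₀`**: for any `d_j ∈ 𝒟` (`j ∈ J_{c₀}`) there is `L ∈ 𝓗` with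
`L(ι_{c₀,j} a₀) = d_j a₀` for every `j` — `L = Σ_j d_j ∘ θ_j ∘ π_j` with `π_j` the equivariant projection onto
`ι_{c₀,j}(A_{c₀})` and `θ_j` the equivariant inverse of `ι_{c₀,j}` (§1). [cite: Serre1977, §2.6]
[cite: Lang2002, XVII §2] -/
theorem exists_mem_homSpace_forall_apply_ι_eq
    (h𝓗 : ∀ L : (Y₀ → ℚ) →ₗ[ℚ] (Yc c₀ → ℚ), L ∈ 𝓗 ↔ (∀ f, L f ∈ Ar c₀) ∧
      ∀ (k : G) (f : Y₀ → ℚ), L (fun x => f (k • x)) = fun y => L f (k • y))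
    (h𝒟 : ∀ L : (Yc c₀ → ℚ) →ₗ[ℚ] (Yc c₀ → ℚ), L ∈ 𝒟 ↔ (∀ a ∈ Ar c₀, L a ∈ Ar c₀) ∧
      ∀ (k : G) (a : Yc c₀ → ℚ), a ∈ Ar c₀ → L (fun y => a (k • y)) = fun y => L a (k • y))
    (hRst : ∀ c (k : G) (a : Yc c → ℚ), a ∈ Ar c → (fun y => a (k • y)) ∈ Ar c)
    (ι : ∀ c, JJ c → ((Yc c → ℚ) →ₗ[ℚ] (Y₀ → ℚ)))
    (hιeq : ∀ c (j : JJ c) (k : G) (a : Yc c → ℚ), a ∈ Ar c →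
      ι c j (fun y => a (k • y)) = fun y => ι c j a (k • y))
    (hinj : ∀ (j : JJ c₀) (a : Yc c₀ → ℚ), a ∈ Ar c₀ → ι c₀ j a = 0 → a = 0)
    (hindep : iSupIndep fun q : (Σ c, JJ c) => (Ar q.1).map (ι q.1 q.2))
    (htop : (⨆ c, ⨆ j, (Ar c).map (ι c j)) = ⊤)
    {a₀ : Yc c₀ → ℚ} (ha₀ : a₀ ∈ Ar c₀)
    {d : JJ c₀ → ((Yc c₀ → ℚ) →ₗ[ℚ] (Yc c₀ → ℚ))} (hd : ∀ j, d j ∈ 𝒟) :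
    ∃ L ∈ 𝓗, ∀ j : JJ c₀, L (ι c₀ j a₀) = d j a₀ := by
  have hdA : ∀ j, ∀ a ∈ Ar c₀, d j a ∈ Ar c₀ := fun j => ((h𝒟 (d j)).1 (hd j)).1
  have hdeq : ∀ (j : JJ c₀) (k : G) (a : Yc c₀ → ℚ), a ∈ Ar c₀ →
      d j (fun y => a (k • y)) = fun y => d j a (k • y) := fun j => ((h𝒟 (d j)).1 (hd j)).2
  -- projections onto the class-`c₀` summands and inverses of the embeddings
  have hproj := fun j : JJ c₀ => exists_equivariant_proj_summand hRst ι hιeq hindep htop ⟨c₀, j⟩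
  choose π hπmem hπid hπkill hπeq using hproj
  have hinv := fun j : JJ c₀ => exists_equivariant_inverse (hRst c₀) (ι c₀ j) (hinj j) (hιeq c₀ j)
  choose θ hθinv hθmem hθeq using hinv
  let L : (Y₀ → ℚ) →ₗ[ℚ] (Yc c₀ → ℚ) := ∑ j, d j ∘ₗ θ j ∘ₗ π j
  refine ⟨L, (h𝓗 L).2 ⟨fun f => ?_, fun k f => ?_⟩, fun j => ?_⟩
  · rw [LinearMap.sum_apply]
    exact Submodule.sum_mem _ fun j _ => hdA j _ (hθmem j _ (hπmem j f))
  · rw [LinearMap.sum_apply, LinearMap.sum_apply]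
    funext y
    rw [Finset.sum_apply, Finset.sum_apply]
    refine Finset.sum_congr rfl fun j _ => ?_
    simp only [LinearMap.comp_apply]
    rw [hπeq j k f, hθeq j k _ (hπmem j f), hdeq j k _ (hθmem j _ (hπmem j f))]
  · rw [LinearMap.sum_apply, Finset.sum_eq_single j (fun j' _ hj' => ?_)
      (fun h => absurd (Finset.mem_univ j) h)]
    · simp only [LinearMap.comp_apply]
      rw [hπid j _ (Submodule.mem_map_of_mem ha₀), hθinv j a₀ ha₀]
    · simp only [LinearMap.comp_apply]
      have hne : (⟨c₀, j⟩ : Σ c, JJ c) ≠ ⟨c₀, j'⟩ := fun h => by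
        injection h with _ h2
        exact hj' h2.symm
      rw [hπkill j' ⟨c₀, j⟩ hne _ (Submodule.mem_map_of_mem ha₀), map_zero, map_zero]

/-- **`Ψ(Hom_G(ℚ^{Y₀}, A_{c₀})) = ∏_{j ∈ J_{c₀}} 𝒟·a₀`** (`Ψ(L) = (L(ι_{c₀,j} a₀))_j`). [cite: Serre1977, §2.6]
[cite: LangeRodriguez2022, §2.8 Lemma 2.8.1] -/
theorem map_homSpace_pi_applyₗ_eq
    (h𝓗 : ∀ L : (Y₀ → ℚ) →ₗ[ℚ] (Yc c₀ → ℚ), L ∈ 𝓗 ↔ (∀ f, L f ∈ Ar c₀) ∧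
      ∀ (k : G) (f : Y₀ → ℚ), L (fun x => f (k • x)) = fun y => L f (k • y))
    (h𝒟 : ∀ L : (Yc c₀ → ℚ) →ₗ[ℚ] (Yc c₀ → ℚ), L ∈ 𝒟 ↔ (∀ a ∈ Ar c₀, L a ∈ Ar c₀) ∧
      ∀ (k : G) (a : Yc c₀ → ℚ), a ∈ Ar c₀ → L (fun y => a (k • y)) = fun y => L a (k • y))
    (hRst : ∀ c (k : G) (a : Yc c → ℚ), a ∈ Ar c → (fun y => a (k • y)) ∈ Ar c)
    (ι : ∀ c, JJ c → ((Yc c → ℚ) →ₗ[ℚ] (Y₀ → ℚ)))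
    (hιeq : ∀ c (j : JJ c) (k : G) (a : Yc c → ℚ), a ∈ Ar c →
      ι c j (fun y => a (k • y)) = fun y => ι c j a (k • y))
    (hinj : ∀ (j : JJ c₀) (a : Yc c₀ → ℚ), a ∈ Ar c₀ → ι c₀ j a = 0 → a = 0)
    (hindep : iSupIndep fun q : (Σ c, JJ c) => (Ar q.1).map (ι q.1 q.2))
    (htop : (⨆ c, ⨆ j, (Ar c).map (ι c j)) = ⊤)
    {a₀ : Yc c₀ → ℚ} (ha₀ : a₀ ∈ Ar c₀) :
    𝓗.map (LinearMap.pi fun j : JJ c₀ =>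
        (LinearMap.applyₗ (ι c₀ j a₀) : ((Y₀ → ℚ) →ₗ[ℚ] (Yc c₀ → ℚ)) →ₗ[ℚ] (Yc c₀ → ℚ))) =
      Submodule.pi Set.univ (fun _ : JJ c₀ => 𝒟.map (LinearMap.applyₗ a₀)) := by
  refine le_antisymm ?_ fun w hw => ?_
  · rintro _ ⟨L, hL, rfl⟩
    exact fun j _ => by
      rw [LinearMap.pi_apply, LinearMap.applyₗ_apply_apply]
      exact apply_ι_mem_map_applyₗ_of_mem_homSpace h𝓗 h𝒟 ι hιeq hL a₀ j
  · have hw' : ∀ j, ∃ dj ∈ 𝒟, dj a₀ = w j := fun j =>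
      (mem_map_applyₗ_iff 𝒟 a₀ (w j)).1 (hw j (Set.mem_univ j))
    choose d hd hdw using hw'
    obtain ⟨L, hL, hLd⟩ := exists_mem_homSpace_forall_apply_ι_eq h𝓗 h𝒟 hRst ι hιeq hinj hindep htop ha₀ hd
    refine ⟨L, hL, funext fun j => ?_⟩
    rw [LinearMap.pi_apply, LinearMap.applyₗ_apply_apply, hLd j, hdw j]

variable [∀ c, Fintype (Yc c)]

/-- **`dim Hom_G(ℚ^{Y₀}, A_{c₀}) = |J_{c₀}|·δ_{c₀}`** (`δ = dim 𝒟·a₀`, `0 ≠ a₀ ∈ A_{c₀}`): `Ψ` is injective on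
`𝓗` with image `∏_j 𝒟·a₀`. [cite: Serre1977, §2.6] [cite: LangeRodriguez2022, §2.8 Lemma 2.8.1] -/
theorem finrank_homSpace_eq_card_mul
    (h𝓗 : ∀ L : (Y₀ → ℚ) →ₗ[ℚ] (Yc c₀ → ℚ), L ∈ 𝓗 ↔ (∀ f, L f ∈ Ar c₀) ∧
      ∀ (k : G) (f : Y₀ → ℚ), L (fun x => f (k • x)) = fun y => L f (k • y))
    (h𝒟 : ∀ L : (Yc c₀ → ℚ) →ₗ[ℚ] (Yc c₀ → ℚ), L ∈ 𝒟 ↔ (∀ a ∈ Ar c₀, L a ∈ Ar c₀) ∧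
      ∀ (k : G) (a : Yc c₀ → ℚ), a ∈ Ar c₀ → L (fun y => a (k • y)) = fun y => L a (k • y))
    (hRst : ∀ c (k : G) (a : Yc c → ℚ), a ∈ Ar c → (fun y => a (k • y)) ∈ Ar c)
    (hRirr : ∀ c (W : Submodule ℚ (Yc c → ℚ)), W ≤ Ar c → W ≠ ⊥ →
      (∀ (k : G) (f : Yc c → ℚ), f ∈ W → (fun y => f (k • y)) ∈ W) → W = Ar c)
    (hsep : ∀ c c' (L : (Yc c → ℚ) →ₗ[ℚ] (Yc c' → ℚ)), c ≠ c' → Ar c ≠ ⊥ → (∀ a ∈ Ar c, L a ∈ Ar c') →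
      (∀ a ∈ Ar c, L a = 0 → a = 0) →
      (∀ (k : G) (a : Yc c → ℚ), a ∈ Ar c → L (fun y => a (k • y)) = fun y => L a (k • y)) → False)
    (ι : ∀ c, JJ c → ((Yc c → ℚ) →ₗ[ℚ] (Y₀ → ℚ)))
    (hιeq : ∀ c (j : JJ c) (k : G) (a : Yc c → ℚ), a ∈ Ar c →
      ι c j (fun y => a (k • y)) = fun y => ι c j a (k • y))
    (hinj : ∀ (j : JJ c₀) (a : Yc c₀ → ℚ), a ∈ Ar c₀ → ι c₀ j a = 0 → a = 0)
    (hindep : iSupIndep fun q : (Σ c, JJ c) => (Ar q.1).map (ι q.1 q.2))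
    (htop : (⨆ c, ⨆ j, (Ar c).map (ι c j)) = ⊤)
    {a₀ : Yc c₀ → ℚ} (ha₀ : a₀ ∈ Ar c₀) (h0 : a₀ ≠ 0) :
    Module.finrank ℚ 𝓗 = Fintype.card (JJ c₀) * Module.finrank ℚ ↥(𝒟.map (LinearMap.applyₗ a₀)) := by
  rw [← finrank_pi_const_eq (𝒟.map (LinearMap.applyₗ a₀)),
    ← map_homSpace_pi_applyₗ_eq h𝓗 h𝒟 hRst ι hιeq hinj hindep htop ha₀]
  exact (finrank_map_eq_finrank_of_injOn _ 𝓗 fun L hL hL0 =>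
    eq_zero_of_mem_homSpace_of_forall_apply_ι_eq_zero h𝓗 h𝒟 hRst hRirr hsep ι hιeq htop ha₀ h0 hL
      fun j => by
        have h := congrFun hL0 j
        rwa [LinearMap.pi_apply, LinearMap.applyₗ_apply_apply] at h).symm

end Psi

end Summit.HodgeConjecture.CorCM.IrrOdd

end
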